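import Mathlib
import HarnessLib

/-!
# WeilTypeLadder · the odd-weight lemma (totients ≡ 2 mod 4) behind THEOREM DP∞

b2b cell `hweil` (packet `run/shared/lean/b2b/hodge-weil/`, report `b2b-hweil-pv3-g49/DP-INFINITY.md` §2.1, prover 3
generation 49). PURE ARITHMETIC of Euler's totient; no geometry, no named fact, no `decide` census.

For a cyclic `ℤ/m`-cover of `ℙ¹` the `p`-VALUATION of the discriminant class of its Prym is the sum of the WEIGHTS
`w(p^k) = φ(m) / (2 φ(p^k))` of its rotation letters of order `p^k` (THEOREM Q / NS′ of the packet), and the split /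
non-split question only sees the primes `p ∣ m` with an ODD (or non-integral) weight. Writing `m = p^e · m'` with
`p ∤ m'` one has `2 w(p^k) = p^(e-k) φ(m')`, so everything reduces to the residue of `φ(m')` modulo `4`:

* `totient_mod_four_eq_two_iff` — **ODD-WEIGHT LEMMA**: `φ(n) ≡ 2 (mod 4)` iff `n = 4` or `n = q^f` or `n = 2 q^f` with
  `q ≡ 3 (mod 4)` prime and `f ≥ 1` (so a level `m` divisible by three odd primes, or by `4` and two odd primes, …,
  has all weights even: every `K`-Weil cyclic-cover Prym of such a level is split, THEOREM DP∞ (W));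
* `totient_prime_pow_mod_four` (odd prime powers), `four_dvd_mul_of_even_of_even`, `four_dvd_totient_of_two_le`
  (the generic divisibility by `4`), and `totient_pow_mul_eq` (`φ(p^e m') = p^(e-k) · φ(m') · φ(p^k)`, the weight
  identity in multiplied-out form).

HONEST LABEL: bookkeeping (elementary number theory, folklore); 0 rungs; nothing of Markman 2025 / Mostaed 2026 /
Perry 2026 is used; no kit job.
-/

-- every declaration of this problem lives in `Summit.HodgeConjecture.HodgeConjecture.…` (summit = sub-problem)
set_option linter.dupNamespace false

namespace Summit.HodgeConjecture.HodgeConjecture.WeilTypeLadder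

/-- The product of two even natural numbers is divisible by `4`. [folklore] -/
theorem four_dvd_mul_of_even_of_even {a b : ℕ} (ha : Even a) (hb : Even b) : 4 ∣ a * b := by
  obtain ⟨x, rfl⟩ := ha
  obtain ⟨y, rfl⟩ := hb
  exact ⟨x * y, by ring⟩

/-- For an ODD number `t`, `t * s ≡ 2 (mod 4)` iff `s ≡ 2 (mod 4)`. [folklore] -/
theorem odd_mul_mod_four_eq_two_iff {t s : ℕ} (ht : Odd t) : t * s % 4 = 2 ↔ s % 4 = 2 := by
  have ht4 : t % 4 = 1 ∨ t % 4 = 3 := by obtain ⟨x, rfl⟩ := ht; omega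
  have hs : s % 4 = 0 ∨ s % 4 = 1 ∨ s % 4 = 2 ∨ s % 4 = 3 := by omega
  rw [Nat.mul_mod]
  rcases ht4 with h | h <;> rcases hs with hs | hs | hs | hs <;> rw [h, hs] <;> norm_num

/-- The totient of an odd prime power `p^k` (`k ≥ 1`) is `≡ 2 (mod 4)` iff `p ≡ 3 (mod 4)` (it is `p^(k-1)(p-1)` with
`p^(k-1)` odd and `p - 1` even). [folklore] -/
theorem totient_prime_pow_mod_four {p k : ℕ} (hp : p.Prime) (hp2 : p ≠ 2) (hk : 0 < k) :
    Nat.totient (p ^ k) % 4 = 2 ↔ p % 4 = 3 := by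
  rw [Nat.totient_prime_pow hp hk]
  have hodd : Odd (p ^ (k - 1)) := (hp.odd_of_ne_two hp2).pow
  rw [odd_mul_mod_four_eq_two_iff hodd]
  have h2 := hp.two_le
  have hpodd : p % 2 = 1 := hp.mod_two_eq_one_iff_ne_two.mpr hp2
  omega

/-- If `n = p^e · n'` with `p` an odd prime, `e ≥ 1`, `p ∤ n'` and `n' ≥ 3`, then `4 ∣ φ(n)` (both `φ(p^e)` and
`φ(n')` are even). [folklore] -/
theorem four_dvd_totient_of_two_le {p e n' : ℕ} (hp : p.Prime) (hp2 : p ≠ 2) (he : 0 < e) (hpn : ¬p ∣ n')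
    (hn' : 3 ≤ n') : 4 ∣ Nat.totient (p ^ e * n') := by
  have hcop : Nat.Coprime (p ^ e) n' :=
    (Nat.Coprime.pow_left e ((Nat.Prime.coprime_iff_not_dvd hp).mpr hpn))
  rw [Nat.totient_mul hcop, Nat.totient_prime_pow hp he]
  have h1 : Even (p ^ (e - 1) * (p - 1)) := (hp.even_sub_one hp2).mul_left _
  have h2 : Even (Nat.totient n') := Nat.totient_even (by omega)
  exact four_dvd_mul_of_even_of_even h1 h2

/-- **ODD-WEIGHT LEMMA** ([P3-g49] 2.1 (a)). `φ(n) ≡ 2 (mod 4)` if and only if `n = 4`, or `n = q^f` or `n = 2·q^f`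
for a prime `q ≡ 3 (mod 4)` and `f ≥ 1`. [folklore; e.g. an exercise on Euler's function] -/
theorem totient_mod_four_eq_two_iff (n : ℕ) :
    Nat.totient n % 4 = 2 ↔
      n = 4 ∨ ∃ q f : ℕ, q.Prime ∧ q % 4 = 3 ∧ 0 < f ∧ (n = q ^ f ∨ n = 2 * q ^ f) := by
  constructor
  · intro h
    have hn0 : n ≠ 0 := by rintro rfl; simp at h
    obtain ⟨a, m, hmodd, rfl⟩ := Nat.exists_eq_two_pow_mul_odd hn0
    have hm0 : m ≠ 0 := by rintro rfl; simp at h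
    have hcop : Nat.Coprime (2 ^ a) m := Nat.Coprime.pow_left a (Nat.coprime_two_left.mpr hmodd)
    rw [Nat.totient_mul hcop] at h
    by_cases hm1 : m = 1
    · -- n = 2^a : φ = 2^(a-1) (a ≥ 1) or 1; ≡ 2 (mod 4) forces a = 2
      subst hm1
      left
      simp only [Nat.totient_one, mul_one] at h ⊢
      rcases Nat.eq_zero_or_pos a with rfl | ha
      · simp at h
      · rw [Nat.totient_prime_pow Nat.prime_two ha] at h
        simp only [Nat.add_one_sub_one, mul_one] at h
        -- 2^(a-1) % 4 = 2 ⟹ a - 1 = 1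
        have ha1 : a - 1 = 1 := by
          rcases Nat.lt_or_ge (a - 1) 2 with hlt | hge
          · interval_cases hh : (a - 1)
            · simp at h
            · rfl
          · exfalso
            obtain ⟨c, hc⟩ := Nat.exists_eq_add_of_le hge
            rw [hc, pow_add] at h
            omega
        have : a = 2 := by omega
        subst this; norm_num
    · -- m odd, m ≠ 1: m ≥ 3, φ(m) even; then φ(2^a) must be odd, a ≤ 1, and φ(m) ≡ 2 (4)
      have hm3 : 3 ≤ m := by
        rcases hmodd with ⟨j, rfl⟩
        omega
      have hmeven : Even (Nat.totient m) := Nat.totient_even (by omega)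
      have ha1 : a ≤ 1 := by
        by_contra ha
        have ha2 : 2 ≤ a := by omega
        have h2even : Even (Nat.totient (2 ^ a)) := by
          rw [Nat.totient_prime_pow Nat.prime_two (by omega)]
          refine (Nat.even_pow.mpr ⟨even_two, by omega⟩).mul_right _
        have h4 := four_dvd_mul_of_even_of_even h2even hmeven
        omega
      have hphi2a : Nat.totient (2 ^ a) = 1 := by
        interval_cases a <;> simp
      rw [hphi2a, one_mul] at h
      -- take an odd prime factor q of m, m = q^f * m'' with q ∤ m''
      obtain ⟨q, hq, hqm⟩ := Nat.exists_prime_and_dvd (show m ≠ 1 from hm1)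
      have hq2 : q ≠ 2 := by
        rintro rfl
        exact (Nat.not_even_iff_odd.mpr hmodd) (even_iff_two_dvd.mpr hqm)
      obtain ⟨f, m'', hqm'', hmeq⟩ := Nat.exists_eq_pow_mul_and_not_dvd hm0 q hq.one_lt.ne'
      have hf : 0 < f := by
        rcases Nat.eq_zero_or_pos f with rfl | hf
        · exfalso; apply hqm''; simpa [hmeq] using hqm
        · exact hf
      have hm''0 : m'' ≠ 0 := by rintro rfl; simp [hmeq] at hm0
      have hm''odd : Odd m'' := by
        have : Odd (q ^ f * m'') := hmeq ▸ hmodd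
        exact (Nat.odd_mul.mp this).2
      -- m'' = 1, else 4 ∣ φ(m)
      have hm''1 : m'' = 1 := by
        by_contra hne
        have h3 : 3 ≤ m'' := by rcases hm''odd with ⟨j, rfl⟩; omega
        have h4 := four_dvd_totient_of_two_le hq hq2 hf hqm'' h3
        rw [← hmeq] at h4
        omega
      rw [hm''1, mul_one] at hmeq
      have hq3 : q % 4 = 3 := by
        rw [hmeq] at h
        exact (totient_prime_pow_mod_four hq hq2 hf).mp h
      right
      refine ⟨q, f, hq, hq3, hf, ?_⟩
      interval_cases a
      · left; simp [hmeq]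
      · right; simp [hmeq]
  · rintro (rfl | ⟨q, f, hq, hq3, hf, hn⟩)
    · decide
    · have hq2 : q ≠ 2 := by rintro rfl; norm_num at hq3
      have hpow : Nat.totient (q ^ f) % 4 = 2 := (totient_prime_pow_mod_four hq hq2 hf).mpr hq3
      rcases hn with rfl | rfl
      · exact hpow
      · have hcop : Nat.Coprime 2 (q ^ f) :=
          Nat.Coprime.pow_right f ((Nat.coprime_primes Nat.prime_two hq).mpr hq2.symm)
        rw [Nat.totient_mul hcop, Nat.totient_two, one_mul]
        exact hpow

/-- The weight identity in multiplied-out form: for a prime `p`, `1 ≤ k ≤ e` and `p ∤ m'`,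
`φ(p^e · m') = p^(e-k) · φ(m') · φ(p^k)`, i.e. `2·w(p^k) = φ(m)/φ(p^k) = p^(e-k) φ(m')` for `m = p^e m'`.
[folklore] -/
theorem totient_pow_mul_eq {p e k m' : ℕ} (hp : p.Prime) (hk : 0 < k) (hke : k ≤ e) (hpm : ¬p ∣ m') :
    Nat.totient (p ^ e * m') = p ^ (e - k) * Nat.totient m' * Nat.totient (p ^ k) := by
  have hcop : Nat.Coprime (p ^ e) m' :=
    Nat.Coprime.pow_left e ((Nat.Prime.coprime_iff_not_dvd hp).mpr hpm)
  rw [Nat.totient_mul hcop, Nat.totient_prime_pow hp (by omega), Nat.totient_prime_pow hp hk]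
  have he : e - 1 = (e - k) + (k - 1) := by omega
  rw [he, pow_add]
  ring

/-- **ODD-WEIGHT CRITERION** ([P3-g49] 2.1 (b), odd `p`): for an odd prime `p`, `1 ≤ k ≤ e`, `p ∤ m'`, the weight
`w(p^k) = φ(p^e m')/(2 φ(p^k))` is an ODD INTEGER — i.e. `φ(p^e m') = 2 w φ(p^k)` with `w` odd — iff
`φ(m') ≡ 2 (mod 4)`, iff `m' = 4` or `m' ∈ {q^f, 2 q^f}` with `q ≡ 3 (mod 4)` (`totient_mod_four_eq_two_iff`). -/
theorem oddWeight_iff {p e k m' : ℕ} (hp : p.Prime) (hp2 : p ≠ 2) (hk : 0 < k) (hke : k ≤ e) (hpm : ¬p ∣ m') :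
    (∃ w : ℕ, Odd w ∧ Nat.totient (p ^ e * m') = 2 * w * Nat.totient (p ^ k)) ↔ Nat.totient m' % 4 = 2 := by
  rw [totient_pow_mul_eq hp hk hke hpm]
  have hpos : 0 < Nat.totient (p ^ k) := Nat.totient_pos.mpr (pow_pos hp.pos k)
  have hodd : Odd (p ^ (e - k)) := (hp.odd_of_ne_two hp2).pow
  constructor
  · rintro ⟨w, hw, h⟩
    have h' : p ^ (e - k) * Nat.totient m' = 2 * w := Nat.eq_of_mul_eq_mul_right hpos h
    rw [← odd_mul_mod_four_eq_two_iff hodd, h']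
    obtain ⟨x, rfl⟩ := hw
    omega
  · intro h
    have h2 : p ^ (e - k) * Nat.totient m' % 4 = 2 := (odd_mul_mod_four_eq_two_iff hodd).mpr h
    refine ⟨p ^ (e - k) * Nat.totient m' / 2, ?_, ?_⟩
    · rw [Nat.odd_iff]
      omega
    · have : 2 * (p ^ (e - k) * Nat.totient m' / 2) = p ^ (e - k) * Nat.totient m' := by omega
      rw [this]

end Summit.HodgeConjecture.HodgeConjecture.WeilTypeLadder
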